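import Mathlib
import HarnessLib
import HarnessLib.Audit
import Summits.ValiantsHypothesis.Statement
import Literature.Barriers.ValiantsHypothesis.MonotoneGap
import Literature.Computability.AlgebraicComplexity.StandardFamilies
import Literature.Computability.AlgebraicComplexity.ValiantClasses
import HarnessLib.Audit.Status.Attr

/-!
Route: CirculantFourier

DORMANT since 2026-08-22T03:29:41Z (reconciler: no traction for 5 d (last activity item-evidence-added at 2026-08-17T02:16:44Z); parked, not closed — `ledger route dormant route-ValiantsHypothesis-CirculantFourier --off` to reactivate) — unstaffed, not closed; items shared with open routes are served there. `ledger route dormant <id> --off` reactivates.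

# Route CirculantFourier — the circulant permanent in Fourier (boson-sampling) coordinates — an
n-variate nonnegative normal form of per ∉ VP with Hrubeš's ε-ladder, a monotone calibration and a
projection-completeness test

It suffices to show X: the CIRCULANT PERMANENT family q_n(x_0,…,x_(n-1)) := per(x_(i−j mod n))_(i,j)
— the permanent restricted to the
regular representation of Z_n, an n-variable projection of per_n — is not p-computable over ℂ (card
group-permanent-fourier-positivity,
thesis "q_(Z_n) ∉ VP"). X ⇒ per not p-computable ⇒ VP_ℂ ≠ VNP_ℂ by two proved tree facts. The route
attacks X in FOURIER COORDINATES: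
after the boson-sampling change of variables x_d = Σ_m ω^(dm) μ_m (ω = e^(2πi/n)) the polynomial
QF_n(μ) := q_n(x(μ)) has NONNEGATIVE
coefficients |per F_α|²/α! (F_α = character matrix with column m repeated α_m times) supported on
the charge-0 slice Σ m·α_m ≡ 0 (mod n),
so X becomes — EQUIVALENTLY, by Hrubeš's ε-sensitivity theorem — a statement of monotone complexity:
for no choice of ε_n ∈ (0,1) does
(1+Σμ_m)^n + ε_n·QF_n have polynomial-size monotone circuits (crux #2), under which sit two strictly
weaker, provable-scale rungs (#3, #4)
and a structural test of whether q is per in disguise (#5).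
Lean: `¬ Literature.Computability.AlgebraicComplexity.IsPComputable (fun n => (Matrix.circulant fun
i : Fin n => (MvPolynomial.X i : MvPolynomial (Fin n) ℂ)).permanent)`

## Assembly
Pure bookkeeping once the supports are in hand: assume the four hypotheses; by CircHub it suffices
to refute IsPComputable q. If
L(q_n) ≤ n^a + a for all n, RealForms gives real forms r_n of QF_n with deg ≤ n and L_ℝ(r_n) ≤
n^(a′) + a′; HrubesBridge with d = n gives,
for each n ≥ 1, some ε₀(n) > 0 and, for ε_n := min(ε₀/2, 1/2) ∈ (0,1), a plain monotone circuit of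
size ≤ C(L_ℝ(r_n) + 2n + 1)³ ≤ n^b + b
computing g_n with map g_n = U_n + ε_n r_n over ℝ, hence (MvPolynomial.map_map, map_add/pow/sum/X/C)
map g_n = U_n + ε_n QF_n over ℂ —
contradicting SensitiveMonotoneHard with c := b. Uses only IsPBounded arithmetic (add/mul/comp_holds
in tree) and ring-hom compatibilities.

Rationale: WHY THIS LINE. Dedekind–Frobenius factorise the group DETERMINANT of an abelian group into linear
characters (a ΠΣ formula), while the group PERMANENT
of Z_n in the same character coordinates is the generating function of n-boson output probabilities
through the Fourier multiport
(AaronsonArkhipovToC2013 §3; Tichy et al. doi:10.1103/PhysRevLett.104.220405;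
Kocharovsky–Kocharovsky doi:10.1016/j.laa.2017.01.024): an
explicit n-variate polynomial with nonnegative, number-theoretic coefficients (permanents of
degenerate Schur matrices, Graham–Lehmer
doi:10.1017/s1446788700019339; orthomorphism counts, arXiv:1510.05987) for which no efficient
algorithm is known (arXiv:2109.01740 p.3;
the algorithms in print — Minc87, CCR97, BCCR99, CR02, KKM21 — handle only a bounded band of nonzero
diagonals). Hrubes2020 Thm 1 (verified from the held ECCC TR19-034 text) turns "f has small
circuits" into
"(1+Σx)^d + εf has small MONOTONE circuits for all small ε", so per ∉ VP acquires an equivalent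
monotone form on a positive n-variate
family — the natural explicit target for the ε-sensitive programme
(ChattopadhyayDattaMukhopadhyay2021, ChattopadhyayDattaGhosalMukhopadhyay2022,
which reach rate 2^(-Ω(n)) for VNP/VP families in n² variables and ask for strongly exponential
targets). Imported areas: representation
theory of finite abelian groups (DFT, characters), linear optics / boson sampling (positivity,
zero-transmission law), monotone and
ε-sensitive arithmetic complexity (JerrumSnir1982, Hrubes2020, CDGM22), analytic number theory of
character sums (coefficient estimates).
What it does that prior routes do not:
Depth4/GCTMult/DetQP/Elusive/TauConst/IntegralGCT/BoolTransfer all keep per_n in n² variables and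
signed coefficients; here the target has n variables, a free abelian symmetry Aff(Z_n), and a
nonnegative normal form on which
monotone technology can be run and calibrated; the negatives index is empty, nothing to steer
around.

RANKED CRUXES. #0 CircPermNotPComputable (target) — X — the circulant permanent family q_n =
per(circulant(x)) ∈ ℂ[x_0..x_(n-1)] is not p-computable (its circuit complexity is not polynomially
bounded). (why it might fail: false iff q ∈ VP: a Borchardt/Dedekind-type identity expressing per of
a group matrix through |G| character blocks (most dangerous for G = Z_2^k), or VP = VNP; no such
identity is known (KKM21 p.3, BCCR99).) [doi:10.1016/j.laa.2017.01.024, arXiv:2109.01740,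
doi:10.1016/s0024-3795(99)00012-9, Burgisser2000]
#2 SensitiveMonotoneHard (crux) — (top rung; X in monotone form) there is no c such that for every n
≥ 1 some ε ∈ (0,1) makes U_n + ε·QF_n, U_n := (1 + Σ_m μ_m)^n, computable by a plain monotone (ℝ≥0,
fan-in-2) circuit of size ≤ n^c + c. Equivalent to X: ⇒ by HrubesBridge + RealForms (Assembly), ⇐ by
TargetImpliesSensitive (card engine (a), Hrubeš reading). [difficulty: open-problem] (why it might
fail: It is X: false iff the circulant permanent has poly-size circuits. As a monotone task it needs
an ε-sensitive bound at ALL rates ε_n → 0, while every known technique dies below ε = 2^(-O(n))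
(CDGM22 §1) and support counting is void against the full-support U_n.) [Hrubes2020,
ChattopadhyayDattaGhosalMukhopadhyay2022, ChattopadhyayDattaMukhopadhyay2021,
doi:10.1016/j.laa.2017.01.024]
#3 MonotoneHard (crux) — (bottom rung, calibration; necessary for X) the Fourier form QF_n itself
has no polynomial-size plain monotone circuits: no c with, for all n ≥ 1, a monotone circuit of size
≤ n^c + c computing the ℝ≥0-polynomial whose image in ℂ[μ] is QF_n (card item C3). [difficulty: L]
(why it might fail: Support methods are void: the charge-0 slice polynomial Σ n!/α! μ^α has O(n³)
monotone circuits (ChargeSliceMonotoneEasy), so a bound must read the VALUES |per F_α|²; a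
product/recursion formula for these Fourier-multiport amplitudes would give small monotone circuits
and kill X too.) [JerrumSnir1982, doi:10.1103/PhysRevLett.104.220405, doi:10.1017/s1446788700019339,
doi:10.1145/3313276.3316311, arXiv:1903.01630]
#4 SensitiveMonotoneHardExpRate (crux) — (middle rung, CDGM-scale) for some rate η > 0 there is no c
such that for every n ≥ 1 some ε with 2^(−ηn) ≤ ε < 1 makes U_n + ε·QF_n computable by a plain
monotone circuit of size ≤ n^c + c. Implied by #2, implies #3; the first ε-sensitive bound for an
n-variate non-multilinear positive family. [deps: MonotoneHard] [difficulty: XL] (why it might fail: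
U_n has full support with coefficients ≥ 1 and ε·QF_n ≤ ε·(n!)² coefficientwise, so at ε ≈ 2^(−ηn)
parse-tree/support counting sees nothing; only discrepancy of the boson measure |per F_α|²/α!
against product measures can work, and the needed anticoncentration is unproved.)
[ChattopadhyayDattaGhosalMukhopadhyay2022, ChattopadhyayDattaMukhopadhyay2021, Hrubes2020,
AaronsonArkhipovToC2013]
#5 PerNotPProjection (crux) — (structure: is q per in disguise?) the permanent family is NOT a
p-projection of the circulant permanent family: there is no p-bounded t with per_n obtained from
q_(t(n)) by substituting variables and complex constants (card item C2; then q is a natural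
VNP-intermediate candidate under p-projections, while X still implies VH). [difficulty: L] (why it
might fail: The Sidon-spaced planting that c-reduces per_m to q_N (triage note: x_0 = 1, ε-scaling,
interpolation over N) may upgrade to an exact projection using root-of-unity constants on spare
diagonals to cancel unwanted patterns; then q is VNP-complete and the item is false (harmless for
X).) [Burgisser2000, Valiant1979, doi:10.1016/s0024-3795(02)00330-0,
doi:10.1007/978-88-470-2107-5_22]
#9 FourierPositivity (support) — (Tichy/AA/KK: boson-sampling positivity) for n ≥ 1 the Fourier form
QF_n is the image of a polynomial with coefficients in ℝ≥0 (indeed coefficient of μ^α = |per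
F_α|²/α!; checked numerically this session for n ≤ 7: all coefficients are nonnegative INTEGERS).
[difficulty: M] [AaronsonArkhipovToC2013, doi:10.1016/j.laa.2017.01.024,
doi:10.1103/PhysRevLett.104.220405]
#9 SupportLaw (support) — (zero-transmission law) every monomial μ^α of QF_n has charge Σ_m m·α_m ≡
0 (mod n) (translate all rows: per F_α picks up the factor ω^charge). [difficulty: M]
[doi:10.1103/PhysRevLett.104.220405, doi:10.1016/j.laa.2017.01.024]
#9 ChargeSliceMonotoneEasy (support) — (why #3 must be coefficient-sensitive) the full charge-0
slice polynomial Σ_(s : [n]→[n], Σ s_i ≡ 0) Π_i μ_(s_i) = Σ_(charge 0) n!/α!·μ^α has plain monotone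
circuits of size O(n³): iterate n times the cyclic convolution of coefficient vectors of (Σ_j μ_j
t^j) modulo t^n − 1 and read off the t^0 coefficient. [difficulty: M] [JerrumSnir1982,
BurgisserClausenShokrollahi1997]
#9 HrubesBridge (support) — (Hrubes2020 Thm 1, rendered in the tree's models with polynomial
overhead) there is an absolute C such that for every real polynomial f in n variables of degree ≤ d
there is ε₀ > 0 with: for all 0 < ε < ε₀, (1 + Σ x_i)^d + ε f is computed by a plain monotone
ℝ≥0-circuit of size ≤ C·(L_ℝ(f) + n + d + 1)³ (print: O(s d² + n log n)). A theorem in print, to be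
formalised; load-bearing for the Assembly. [difficulty: L] [Hrubes2020,
paper:galaxy-pdf-8480837716326541740, ChattopadhyayDattaGhosalMukhopadhyay2022]
#9 RealForms (support) — (realification + Fourier change of variables) uniformly in n ≥ 1, QF_n is
the image of a REAL polynomial r_n of degree ≤ n whose real circuit complexity is ≤ C·(L_ℂ(q_n) + n²
+ 1): substitute the linear forms (O(n²) gates), then simulate complex gates by real and imaginary
parts (≤ 7 real gates per complex gate); r_n = the real part coefficientwise. [difficulty: M]
[Burgisser2000, BurgisserClausenShokrollahi1997]
#9 CircHub (support) — (projection + hub) if the circulant permanent family is not p-computable then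
VP_ℂ ≠ VNP_ℂ: q_n = rename (i,j) ↦ i − j of perPoly (Fin n) ℂ is a projection with t = id, so
IsPComputable per ⇒ IsPComputable q (IsPComputable.of_isPProjection_holds /
complexity_le_of_isProjection), and ¬IsPComputable per ⇔ VP ≠ VNP is
perNotPComputableComplex_iff_holds; ValiantsHypothesis unfolds to VP ℂ ≠ VNP ℂ. [difficulty:
provable-now] [Valiant1979, Burgisser2000]
#9 TargetImpliesSensitive (support) — (converse of the bridge; certifies that #2 is not stronger
than X) if q is not p-computable then SensitiveMonotoneHard: from plain monotone circuits for U_n +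
ε_n QF_n of size n^c + c one gets real circuits for r_n = (g − U_n)/ε_n of size n^c + c + O(n),
complex circuits for QF_n of the same size (map along ℝ → ℂ), and for q_n after the inverse DFT
substitution (+O(n²)), for every n ≥ 1. [difficulty: M] [Hrubes2020, Burgisser2000]

TWO-LAYER PLAN. Foreseen glued splits (none filed now; k ≤ 3, depth 1): MonotoneHard ⇐
NonnegRankBunching (rk₊ of the degree-balanced coefficient
matrix B_n[β,γ] := |per F_(β+γ)|²/(β+γ)!, |β| = ⌊n/2⌋, is superpolynomial) →
BalancedDecompositionToRank (CDGM22 Thm 2.1-type structure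
theorem for homogeneous non-multilinear targets in the plain model: size ≥ rk₊(B_n)/poly(n)) →
MonotoneHard. SensitiveMonotoneHardExpRate ⇐
BosonDiscrepancy (the measure α ↦ |per F_α|²/α! has discrepancy ≤ 2^(−η′n) against every
product-of-two-charge-classes rectangle) →
DiscrepancyTemplate (CDM21/CDGM22 §2 rendered for U_n + ε f) → SensitiveMonotoneHardExpRate.
PerNotPProjection ⇐ OrbitFilling (a projection
puts each per-variable on a full cyclic diagonal, distinct cells on distinct diagonals) →
ChargeObstruction (two permutations differing by
a transposition have unequal diagonal-sum charge, contradicting SupportLaw-type bookkeeping) →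
PerNotPProjection. No split of #2 before #3/#4 move.

KILL CRITERIA. (i) MonotoneHard REFUTED (poly-size monotone circuits for QF_n): then q ∈ VP, X is
false — close `refuted:MonotoneHard`, card outcome
refuted, and the algorithm is news for circulant permanents / Fourier boson sampling. (ii)
SensitiveMonotoneHard refuted (small monotone
circuits for U_n + ε_n QF_n at some ε_n): same conclusion via TargetImpliesSensitive — close
`refuted:SensitiveMonotoneHard`. (iii)
HrubesBridge fails to formalise with polynomial overhead in the tree's plain model: restate with the
print's own model (constants at
leaves are already allowed) — a modelling repair, not a kill. (iv) PerNotPProjection refuted (per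
≤_p q): the route survives as "VH on an
n-variate symmetric normal form" but loses the intermediate-family angle; re-rank #5 → support, no
close. (v) A proof of #3 by a technique
that provably cannot pass rate 2^(−O(n)) leaves #2 exactly as hard as VH with nothing gained — then
let the route go dormant unless #4
moves. (vi) VH proved or refuted elsewhere moots everything.

NOT DECOMPOSED YET. The card's engine (b) — X ⇔ "no poly-size Aff(Z_n)-symmetric
(circular-convolutional) circuit for q_n" by free symmetrisation over the
polynomial-order group Z_n ⋊ Z_n^× — is deliberately NOT filed: Lean lacks Γ-symmetric arithmetic
circuits (Dawar–Wilsenach,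
DawarWilsenach2025 / arXiv:2002.06451) and no lower-bound technology exists for abelian symmetry
(supports trivialise); it returns as a
definition request + crux if #3 closes. Also parked: c-completeness of q under oracle reductions
(needs oracle circuits; triage expects
per ≤_c q, i.e. X ⇔ VH), the non-abelian dichotomy (regular representation of S_k should be
VNP-complete), the Hadamard case G = Z_2^k,
integrality of QF_n's coefficients (observed n ≤ 5), the exact small-n data (monotone size,
rk₊(B_n), Newton polytope = charge slice) for
n ≤ 8 as kit jobs, and every constant (η, C). Layer-2 children only after a crux closes; helper
lemmas ride with --supports.

CHEAPEST FALSIFIER. Two cheap checks, refuters first: (1) LOOKUP — an efficient classical formula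
for ALL output probabilities |per F_α|²/α! of n single
photons through the n-mode Fourier multiport (Tichy 2010/2014 suppression laws and their
generalisations, e.g. doi:10.1088/1367-2630/aaad92;
Shchesnovich; "efficient simulation of Fourier interferometers") or a polynomial-time algorithm for
GENERIC circulant permanents (BCCR99
doi:10.1016/s0024-3795(99)00012-9, CR02, KKM21 arXiv:2109.01740 report none; CSW02 = ECCC TR02-071
read here: approximation ≡ exact mod p,
hardness assumed) — either would sink #3 and with it X. (2) COMPUTE — for n ≤ 7 lower-bound rk₊ of
the bunching matrix B_n (fooling sets /
rectangle covering of its support-with-values pattern; hours of kit time): if rk₊(B_n) ≤ n²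
persists, #3's foreseen split is wrong-headed.
Run here (python, this session): QF_n for n ≤ 7 has nonnegative INTEGER coefficients; support = the
full charge-0 slice for n ≤ 5 and
n = 7 (2, 4, 10, 26, 246 monomials) but only 68 of the 80 slice monomials for n = 6 (12 extra Tichy
suppressions); [μ_m^n] = n!,
per F_n = −3, −5, −105 (n = 3, 5, 7) and 0 for even n ≤ 8 — positivity and support law confirmed, no
anomaly.

NUMBERS. Coefficients: [μ^α]QF_n = |per F_α|²/α! with F_α ⊂ (ω^(im)); [μ_m^n] = n!; [μ_0μ_1⋯μ_(n−1)]
= |per F_n|², per of Schur's matrix: −3, −5, −105 at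
n = 3, 5, 7 and 0 at even n ≤ 8 (computed here; Graham–Lehmer doi:10.1017/s1446788700019339 for the
prime series); coefficients are
integers ≤ (n!)² (max 32, 1296, 11025 at n = 4, 6, 7); in x-coordinates [x_0⋯x_(n−1)]q_n = number
of orthomorphisms of Z_n ~ e^(−1/2) n!²/n^(n−1) (arXiv:1510.05987). Support: ⊆ charge-0 slice of
size ~ C(2n−1,n)/n (slice sizes 2, 4, 10, 26, 80, 246 for n = 2..7;
equality except at n = 6, where 12 slice monomials are suppressed); term count of q_n in
x-coordinates: Brualdi–Newman / H. Thomas arXiv:math/0301048. Monotone benchmarks: per_n needs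
exactly
n(2^(n−1)−1) monotone multiplications (JerrumSnir1982 §4.3); ST_n: 2^(Ω(n)) monotone yet in VP
(MonotoneGap); ε-sensitive: rate 2^(−ηn)
for F ∓ ε·ST (CDGM22), 2^(−Ω(√N)) for a VNP design polynomial (CDM21); Hrubeš overhead O(s d² + n
log n), his ε₀ doubly-exponentially
small in s. Algorithms: circulants with k = O(1) nonzero diagonals in poly time (Minc 1987
doi:10.1016/0024-3795(87)90285-0, CCR97, BCCR99,
CR02, KKM21); generic circulant: none known. Items at open: 13 (1 target, 4 cruxes, 7 support, 1
assembly).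

DEFINITION REQUESTS. None required at open (all 13 items elaborate over existing declarations; lean
check rc 0). Cosmetic, to be filed when a grounder has
slack: `circPermPoly n k := (Matrix.circulant fun i : Fin n => X i).permanent` and `fourierForm n :=
aeval (d ↦ Σ_m C ω^(dm) · X m)
(circPermPoly n ℂ)` in Literature/Computability/AlgebraicComplexity (the items inline these terms
verbatim). Parked (see Not decomposed
yet): `SymmetricArithCircuit Γ` (Γ-invariant circuits à la Dawar–Wilsenach) for the equivariant form
of X. Cite fact wanted (acq-01800
open): BCCR99's comparison of dense-circulant vs general permanent complexity.

Novelty: Searches (2026-08-15): `lit search --source zbmath "permanent circulant"` (10: Minc87, CCR97,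
BCCR99, CR02, Cummings–Wallis77,
Brualdi–Newman70, Eades–Praeger–Seberry83, Salvi–Salvi06, …, all O(1)-diagonal or enumerative); `lit
search --source s2 "permanent of
circulant matrix"` (8: KKM21 arXiv:2109.01740, H. Thomas arXiv:math/0301048,
Colarte–Mezzetti–Miró-Roig arXiv:1806.05905 (Togliatti
systems from circulant per/det coefficients — no complexity), Schur-matrix permanent
doi:10.1017/s1446788700019339, Codenotti–Resta 2001);
`--source zbmath/crossref` for KK2017 (doi:10.1016/j.laa.2017.01.024) and "group matrix permanent"
(Marcus 1963/69, Beasley–Cummings 1972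
'permanent groups' — unrelated); `lit galaxy search "circulant permanent" | "permanent of a
circulant matrix" --star all` (3+2 rows:
Minc's book panama:322139727069273; Codenotti–Shparlinski–Winterhof ECCC TR02-071 = pdf:302440620,
READ pp.1–4: exact ≡ approximate mod p
for circulant permanents, hardness assumed; KKM21 PMC copy); `lit galaxy search "sensitive monotone"
--star pdf` (4: Hrubeš TR19-034 READ
— Thm 1 verbatim; CDM21 ECCC TR20-166; OWR 2024/15); `lit frontier ValiantsHypothesis --since 2022`
(30 rows; monotone-related
arXiv:2605.09551, arXiv:2507.16105, neither on circulants or ε-sensitivity of positive normal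
forms); `lit bridges --cross any` (books
only); arXiv / OpenAlex / S2 APIs returned HTTP 429 for part of the session (remote 'Fourier boson
sampling suppression' sweep
incomplete — one S2 hit doi:10.1  [refs: 10.1017/s1446788700019339, 10.1016/j.laa.2017.01.024, 10.1088/1367-2630/aaad92, 10.3390/e22030322, 10.1103/PhysRevLett.104.220405, 2109.01740, math/0301048, 1806.05905, 2605.09551, 2507.16105, doi:10.1017/s1446788700019339, doi:10.1016/j.laa.2017.01.024, doi:10.1088/1367-2630/aaad92, doi:10.3390/e22030322, doi:10.1103/PhysRevLett.104.220405, AaronsonArkhipovToC2013, Hrubes2020, ChattopadhyayDattaG]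

Barriers (technique_class: restricted-family, eps-sensitive-monotone, boson-positivity): - technique_class: restricted-family, eps-sensitive-monotone, boson-positivity
- Literature.Barriers.ValiantsHypothesis.MonotoneGap: applies verbatim to any reading of #3 or #4 as
a general lower bound — they are NOT so read (calibration rungs only); the transfer used is exactly
the catalogued evasion, Hrubeš's Thm 1 at ε → 0 (#2 quantifies over ALL ε_n ∈ (0,1)), for which ST_n
and planar matchings are not counterexamples (they satisfy the analogue of #3 and fail the analogue
of #2, consistently with ST ∈ VP). Honest: the barrier's moral survives as the difficulty of #2 —
every technique now known stops at rate 2^(−O(n)).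
- Literature.Barriers.ValiantsHypothesis.FullRankMultilinear: QF_n is homogeneous of degree n in n
variables, not multilinear; the foreseen route to #3 is nonnegative rank of a degree-balanced
coefficient matrix plus a structure theorem, and rk₊ is not bounded by the partial-derivative rank
the barrier caps — but any proof that only uses ordinary rank of B_n as a proxy inherits the cap;
the bet is on values/discrepancy, not rank.
- Literature.Barriers.ValiantsHypothesis.RankMethods: not engaged by #2–#4 (monotone size and rk₊
are not sub-additive rank measures μ_L); it does explain why X is not attacked head-on by
flattenings of the n-variate q_n (rank measures give only polynomial bounds for general circuits) —
hence the detour through positivity.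
- Literature.Barriers.ValiantsHypothesis.PartialDerivativesDetPerm: same remark; no flattening-rank
profile of

History (route lifecycle, newest last):
- 2026-08-16T04:20:00Z · AUTO-CRUX (backfill): CircPermNotPComputable — hypotheses of the deciding theorem that nothing in the route derives are cruxes (operator:999:1085951)
- 2026-08-22T03:29:41Z · DORMANT — reconciler: no traction for 5 d (last activity item-evidence-added at 2026-08-17T02:16:44Z); parked, not closed — `ledger route dormant route-ValiantsHypothesis (operator:999:384546)

sub-problem: ValiantsHypothesis · status: dormant · opened planner-plancard-ValiantsHypothesis-ValiantsH-6434c205-0 2026-08-15T11:45:44Z · rev 2 · ledger route-ValiantsHypothesis-CirculantFourier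
GENERATED by the gate from the ledger (D-0016/17). Provers cite these decls: `theorem foo : Summit.ValiantsHypothesis.ValiantsHypothesis.Theses.CirculantFourier.<Decl> := …` in Summits/ValiantsHypothesis/ValiantsHypothesis/Theorems/<Name>.lean.
-/

namespace Summit.ValiantsHypothesis.ValiantsHypothesis.Theses.CirculantFourier

open scoped BigOperators Topology Manifold Classical MeasureTheory ProbabilityTheory Matrix InnerProductSpace ComplexConjugate ContinuousMap
open Filter Set Function TopologicalSpace MeasureTheory

attribute [summit_statement] _root_.ValiantsHypothesis

open Literature.PNP

/-- item stmt-ValiantsHypothesis-6301 · crux (kind.auto-crux: conjecture-grade) · rank 0 · open · by planner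
why it might fail: false iff q ∈ VP: a Borchardt/Dedekind-type identity expressing per of a group matrix through |G| character blocks (most dangerous for G = Z_2^k), or VP = VNP; no such identity is known (KKM21 p.3, BCCR99).
sources: doi:10.1016/j.laa.2017.01.024, arXiv:2109.01740, doi:10.1016/s0024-3795(99)00012-9, Burgisser2000
[target] X — the circulant permanent family q_n = per(circulant(x)) ∈ ℂ[x_0..x_(n-1)] is not
p-computable (its circuit complexity is not polynomially bounded). -/
@[route_item "route-ValiantsHypothesis-CirculantFourier", crux]
def CircPermNotPComputable : Prop :=
  ¬ Literature.Computability.AlgebraicComplexity.IsPComputable (fun n => (Matrix.circulant fun i : Fin n => (MvPolynomial.X i : MvPolynomial (Fin n) ℂ)).permanent)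

/-- item stmt-ValiantsHypothesis-6302 · crux · rank 2 · open · by planner
why it might fail: It is X: false iff the circulant permanent has poly-size circuits. As a monotone task it needs an ε-sensitive bound at ALL rates ε_n → 0, while every known technique dies below ε = 2^(-O(n)) (CDGM22 §1) and support counting is void against the full-support U_n.
sources: Hrubes2020, ChattopadhyayDattaGhosalMukhopadhyay2022, ChattopadhyayDattaMukhopadhyay2021, doi:10.1016/j.laa.2017.01.024
[crux] (top rung; X in monotone form) there is no c such that for every n ≥ 1 some ε ∈ (0,1) makes
U_n + ε·QF_n, U_n := (1 + Σ_m μ_m)^n, computable by a plain monotone (ℝ≥0, fan-in-2) circuit of size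
≤ n^c + c. Equivalent to X: ⇒ by HrubesBridge + RealForms (Assembly), ⇐ by TargetImpliesSensitive
(card engine (a), Hrubeš reading). [difficulty: open-problem] -/
@[route_item "route-ValiantsHypothesis-CirculantFourier"]
def SensitiveMonotoneHard : Prop :=
  ¬ ∃ c : ℕ, ∀ n : ℕ, 1 ≤ n → ∃ ε : ℝ, 0 < ε ∧ ε < 1 ∧ ∃ (g : MvPolynomial (Fin n) NNReal) (P : Literature.Computability.AlgebraicComplexity.ArithCircuit NNReal (Fin n)), MvPolynomial.map (Complex.ofRealHom.comp NNReal.toRealHom) g = (1 + ∑ i : Fin n, MvPolynomial.X i) ^ n + MvPolynomial.C (ε : ℂ) * (MvPolynomial.aeval (fun d : Fin n => ∑ m : Fin n, MvPolynomial.C (Complex.exp (2 * Real.pi * Complex.I * ((d : ℕ) : ℂ) * ((m : ℕ) : ℂ) / (n : ℂ))) * MvPolynomial.X m) (Matrix.circulant fun i : Fin n => (MvPolynomial.X i : MvPolynomial (Fin n) ℂ)).permanent) ∧ Literature.Barriers.ValiantsHypothesis.IsMonotoneComputation P g ∧ P.size ≤ n ^ c + c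

/-- item stmt-ValiantsHypothesis-6303 · crux · rank 3 · open · by planner
why it might fail: Support methods are void: the charge-0 slice polynomial Σ n!/α! μ^α has O(n³) monotone circuits (ChargeSliceMonotoneEasy), so a bound must read the VALUES |per F_α|²; a product/recursion formula for these Fourier-multiport amplitudes would give small monotone circuits and kill X too.
sources: JerrumSnir1982, doi:10.1103/PhysRevLett.104.220405, doi:10.1017/s1446788700019339, doi:10.1145/3313276.3316311, arXiv:1903.01630
[crux] (bottom rung, calibration; necessary for X) the Fourier form QF_n itself has no
polynomial-size plain monotone circuits: no c with, for all n ≥ 1, a monotone circuit of size ≤ n^c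
+ c computing the ℝ≥0-polynomial whose image in ℂ[μ] is QF_n (card item C3). [difficulty: L] -/
@[route_item "route-ValiantsHypothesis-CirculantFourier"]
def MonotoneHard : Prop :=
  ¬ ∃ c : ℕ, ∀ n : ℕ, 1 ≤ n → ∃ (g : MvPolynomial (Fin n) NNReal) (P : Literature.Computability.AlgebraicComplexity.ArithCircuit NNReal (Fin n)), MvPolynomial.map (Complex.ofRealHom.comp NNReal.toRealHom) g = (MvPolynomial.aeval (fun d : Fin n => ∑ m : Fin n, MvPolynomial.C (Complex.exp (2 * Real.pi * Complex.I * ((d : ℕ) : ℂ) * ((m : ℕ) : ℂ) / (n : ℂ))) * MvPolynomial.X m) (Matrix.circulant fun i : Fin n => (MvPolynomial.X i : MvPolynomial (Fin n) ℂ)).permanent) ∧ Literature.Barriers.ValiantsHypothesis.IsMonotoneComputation P g ∧ P.size ≤ n ^ c + c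

/-- item stmt-ValiantsHypothesis-6304 · crux · rank 4 · open · by planner
why it might fail: U_n has full support with coefficients ≥ 1 and ε·QF_n ≤ ε·(n!)² coefficientwise, so at ε ≈ 2^(−ηn) parse-tree/support counting sees nothing; only discrepancy of the boson measure |per F_α|²/α! against product measures can work, and the needed anticoncentration is unproved.
sources: ChattopadhyayDattaGhosalMukhopadhyay2022, ChattopadhyayDattaMukhopadhyay2021, Hrubes2020, AaronsonArkhipovToC2013
[crux] (middle rung, CDGM-scale) for some rate η > 0 there is no c such that for every n ≥ 1 some ε
with 2^(−ηn) ≤ ε < 1 makes U_n + ε·QF_n computable by a plain monotone circuit of size ≤ n^c + c.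
Implied by #2, implies #3; the first ε-sensitive bound for an n-variate non-multilinear positive
family. [deps: MonotoneHard] [difficulty: XL] -/
@[route_item "route-ValiantsHypothesis-CirculantFourier"]
def SensitiveMonotoneHardExpRate : Prop :=
  ∃ η : ℝ, 0 < η ∧ ¬ ∃ c : ℕ, ∀ n : ℕ, 1 ≤ n → ∃ ε : ℝ, (2 : ℝ) ^ (-(η * (n : ℝ))) ≤ ε ∧ ε < 1 ∧ ∃ (g : MvPolynomial (Fin n) NNReal) (P : Literature.Computability.AlgebraicComplexity.ArithCircuit NNReal (Fin n)), MvPolynomial.map (Complex.ofRealHom.comp NNReal.toRealHom) g = (1 + ∑ i : Fin n, MvPolynomial.X i) ^ n + MvPolynomial.C (ε : ℂ) * (MvPolynomial.aeval (fun d : Fin n => ∑ m : Fin n, MvPolynomial.C (Complex.exp (2 * Real.pi * Complex.I * ((d : ℕ) : ℂ) * ((m : ℕ) : ℂ) / (n : ℂ))) * MvPolynomial.X m) (Matrix.circulant fun i : Fin n => (MvPolynomial.X i : MvPolynomial (Fin n) ℂ)).permanent) ∧ Literature.Barriers.ValiantsHypothesis.IsMonotoneComputation P g ∧ P.size ≤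 n ^ c + c

/-- item stmt-ValiantsHypothesis-6305 · crux · rank 5 · open · by planner
why it might fail: The Sidon-spaced planting that c-reduces per_m to q_N (triage note: x_0 = 1, ε-scaling, interpolation over N) may upgrade to an exact projection using root-of-unity constants on spare diagonals to cancel unwanted patterns; then q is VNP-complete and the item is false (harmless for X).
sources: Burgisser2000, Valiant1979, doi:10.1016/s0024-3795(02)00330-0, doi:10.1007/978-88-470-2107-5_22
[crux] (structure: is q per in disguise?) the permanent family is NOT a p-projection of the
circulant permanent family: there is no p-bounded t with per_n obtained from q_(t(n)) by
substituting variables and complex constants (card item C2; then q is a natural VNP-intermediate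
candidate under p-projections, while X still implies VH). [difficulty: L] -/
@[route_item "route-ValiantsHypothesis-CirculantFourier"]
def PerNotPProjection : Prop :=
  ¬ Literature.Computability.AlgebraicComplexity.IsPProjection (fun n => Literature.Computability.AlgebraicComplexity.perPoly (Fin n) ℂ) (fun n => (Matrix.circulant fun i : Fin n => (MvPolynomial.X i : MvPolynomial (Fin n) ℂ)).permanent)

/-- item stmt-ValiantsHypothesis-6306 · support · rank 9 · closed · proved by Summit.ValiantsHypothesis.ValiantsHypothesis.Theorems.fourierPositivity_proof (prover) · by planner
sources: AaronsonArkhipovToC2013, doi:10.1016/j.laa.2017.01.024, doi:10.1103/PhysRevLett.104.220405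
[support] (Tichy/AA/KK: boson-sampling positivity) for n ≥ 1 the Fourier form QF_n is the image of a
polynomial with coefficients in ℝ≥0 (indeed coefficient of μ^α = |per F_α|²/α!; checked numerically
this session for n ≤ 7: all coefficients are nonnegative INTEGERS). [difficulty: M] -/
@[route_item "route-ValiantsHypothesis-CirculantFourier"]
def FourierPositivity : Prop :=
  ∀ n : ℕ, 1 ≤ n → ∃ g : MvPolynomial (Fin n) NNReal, MvPolynomial.map (Complex.ofRealHom.comp NNReal.toRealHom) g = (MvPolynomial.aeval (fun d : Fin n => ∑ m : Fin n, MvPolynomial.C (Complex.exp (2 * Real.pi * Complex.I * ((d : ℕ) : ℂ) * ((m : ℕ) : ℂ) / (n : ℂ))) * MvPolynomial.X m) (Matrix.circulant fun i : Fin n => (MvPolynomial.X i : MvPolynomial (Fin n) ℂ)).permanent)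

/-- item stmt-ValiantsHypothesis-6307 · support · rank 9 · closed · proved by Summit.ValiantsHypothesis.ValiantsHypothesis.Theorems.supportLaw_proof @ 00a8cdd78641 (prover) · by planner
sources: doi:10.1103/PhysRevLett.104.220405, doi:10.1016/j.laa.2017.01.024
[support] (zero-transmission law) every monomial μ^α of QF_n has charge Σ_m m·α_m ≡ 0 (mod n)
(translate all rows: per F_α picks up the factor ω^charge). [difficulty: M] -/
@[route_item "route-ValiantsHypothesis-CirculantFourier"]
def SupportLaw : Prop :=
  ∀ n : ℕ, 1 ≤ n → ∀ α : Fin n →₀ ℕ, MvPolynomial.coeff α (MvPolynomial.aeval (fun d : Fin n => ∑ m : Fin n, MvPolynomial.C (Complex.exp (2 * Real.pi * Complex.I * ((d : ℕ) : ℂ) * ((m : ℕ) : ℂ) / (n : ℂ))) * MvPolynomial.X m) (Matrix.circulant fun i : Fin n => (MvPolynomial.X i : MvPolynomial (Fin n) ℂ)).permanent) ≠ 0 → (∑ j : Fin n, (j : ℕ) * α j) % n = 0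

/-- item stmt-ValiantsHypothesis-6308 · support · rank 9 · closed · proved by Summit.ValiantsHypothesis.ValiantsHypothesis.Theorems.CirculantFourierChargeSliceMonotoneEasy.chargeSliceMonotoneEasy_proof (prover) · by planner
sources: JerrumSnir1982, BurgisserClausenShokrollahi1997
[support] (why #3 must be coefficient-sensitive) the full charge-0 slice polynomial Σ_(s : [n]→[n],
Σ s_i ≡ 0) Π_i μ_(s_i) = Σ_(charge 0) n!/α!·μ^α has plain monotone circuits of size O(n³): iterate n
times the cyclic convolution of coefficient vectors of (Σ_j μ_j t^j) modulo t^n − 1 and read off the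
t^0 coefficient. [difficulty: M] -/
@[route_item "route-ValiantsHypothesis-CirculantFourier"]
def ChargeSliceMonotoneEasy : Prop :=
  ∃ C : ℕ, ∀ n : ℕ, 1 ≤ n → ∃ P : Literature.Computability.AlgebraicComplexity.ArithCircuit NNReal (Fin n), Literature.Barriers.ValiantsHypothesis.IsMonotoneComputation P (∑ s : Fin n → Fin n, (if (∑ i : Fin n, ((s i : Fin n) : ℕ)) % n = 0 then ∏ i : Fin n, MvPolynomial.X (s i) else 0 : MvPolynomial (Fin n) NNReal)) ∧ P.size ≤ C * n ^ 3

/-- item stmt-ValiantsHypothesis-6309 · support · rank 9 · closed · proved by Summit.ValiantsHypothesis.ValiantsHypothesis.Theorems.CirculantFourierHrubes.hrubesBridge_proof @ cd49fa7ee78d (prover) · by planner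
sources: Hrubes2020, paper:galaxy-pdf-8480837716326541740, ChattopadhyayDattaGhosalMukhopadhyay2022
[support] (Hrubes2020 Thm 1, rendered in the tree's models with polynomial overhead) there is an
absolute C such that for every real polynomial f in n variables of degree ≤ d there is ε₀ > 0 with:
for all 0 < ε < ε₀, (1 + Σ x_i)^d + ε f is computed by a plain monotone ℝ≥0-circuit of size ≤
C·(L_ℝ(f) + n + d + 1)³ (print: O(s d² + n log n)). A theorem in print, to be formalised;
load-bearing for the Assembly. [difficulty: L] -/
@[route_item "route-ValiantsHypothesis-CirculantFourier"]
def HrubesBridge : Prop :=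
  ∃ C : ℕ, ∀ (n d : ℕ) (f : MvPolynomial (Fin n) ℝ), f.totalDegree ≤ d → ∃ ε₀ : ℝ, 0 < ε₀ ∧ ∀ ε : ℝ, 0 < ε → ε < ε₀ → ∃ (g : MvPolynomial (Fin n) NNReal) (P : Literature.Computability.AlgebraicComplexity.ArithCircuit NNReal (Fin n)), MvPolynomial.map NNReal.toRealHom g = (1 + ∑ i : Fin n, MvPolynomial.X i) ^ d + MvPolynomial.C ε * f ∧ Literature.Barriers.ValiantsHypothesis.IsMonotoneComputation P g ∧ P.size ≤ C * (Literature.Computability.AlgebraicComplexity.complexity f + n + d + 1) ^ 3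

/-- item stmt-ValiantsHypothesis-6310 · support · rank 9 · closed · proved by Summit.ValiantsHypothesis.ValiantsHypothesis.Theorems.realForms_proof @ 9cdc436e852d (prover) · by planner
sources: Burgisser2000, BurgisserClausenShokrollahi1997
[support] (realification + Fourier change of variables) uniformly in n ≥ 1, QF_n is the image of a
REAL polynomial r_n of degree ≤ n whose real circuit complexity is ≤ C·(L_ℂ(q_n) + n² + 1):
substitute the linear forms (O(n²) gates), then simulate complex gates by real and imaginary parts
(≤ 7 real gates per complex gate); r_n = the real part coefficientwise. [difficulty: M] -/
@[route_item "route-ValiantsHypothesis-CirculantFourier"]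
def RealForms : Prop :=
  ∃ C : ℕ, ∀ n : ℕ, 1 ≤ n → ∃ r : MvPolynomial (Fin n) ℝ, MvPolynomial.map Complex.ofRealHom r = (MvPolynomial.aeval (fun d : Fin n => ∑ m : Fin n, MvPolynomial.C (Complex.exp (2 * Real.pi * Complex.I * ((d : ℕ) : ℂ) * ((m : ℕ) : ℂ) / (n : ℂ))) * MvPolynomial.X m) (Matrix.circulant fun i : Fin n => (MvPolynomial.X i : MvPolynomial (Fin n) ℂ)).permanent) ∧ r.totalDegree ≤ n ∧ Literature.Computability.AlgebraicComplexity.complexity r ≤ C * (Literature.Computability.AlgebraicComplexity.complexity (Matrix.circulant fun i : Fin n => (MvPolynomial.X i : MvPolynomial (Fin n) ℂ)).permanent + n * n + 1)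

/-- item stmt-ValiantsHypothesis-6311 · support · rank 9 · closed · proved by Summit.ValiantsHypothesis.ValiantsHypothesis.Theorems.CirculantFourier.circHub_proof @ 3b72319e5465 (prover) · by planner
sources: Valiant1979, Burgisser2000
[support] (projection + hub) if the circulant permanent family is not p-computable then VP_ℂ ≠
VNP_ℂ: q_n = rename (i,j) ↦ i − j of perPoly (Fin n) ℂ is a projection with t = id, so IsPComputable
per ⇒ IsPComputable q (IsPComputable.of_isPProjection_holds / complexity_le_of_isProjection), and
¬IsPComputable per ⇔ VP ≠ VNP is perNotPComputableComplex_iff_holds; ValiantsHypothesis unfolds to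
VP ℂ ≠ VNP ℂ. [difficulty: provable-now] -/
@[route_item "route-ValiantsHypothesis-CirculantFourier", crux]
def CircHub : Prop :=
  ¬ Literature.Computability.AlgebraicComplexity.IsPComputable (fun n => (Matrix.circulant fun i : Fin n => (MvPolynomial.X i : MvPolynomial (Fin n) ℂ)).permanent) → ValiantsHypothesis

/-- item stmt-ValiantsHypothesis-6312 · support · rank 9 · closed · proved by Summit.ValiantsHypothesis.ValiantsHypothesis.Theorems.targetImpliesSensitive_proof @ 687b2fe66b16 (prover) · by planner
sources: Hrubes2020, Burgisser2000
[support] (converse of the bridge; certifies that #2 is not stronger than X) if q is not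
p-computable then SensitiveMonotoneHard: from plain monotone circuits for U_n + ε_n QF_n of size n^c
+ c one gets real circuits for r_n = (g − U_n)/ε_n of size n^c + c + O(n), complex circuits for QF_n
of the same size (map along ℝ → ℂ), and for q_n after the inverse DFT substitution (+O(n²)), for
every n ≥ 1. [difficulty: M] -/
@[route_item "route-ValiantsHypothesis-CirculantFourier"]
def TargetImpliesSensitive : Prop :=
  CircPermNotPComputable → SensitiveMonotoneHard

/-- item stmt-ValiantsHypothesis-6313 · assembly · rank 1 · closed · proved by Summit.ValiantsHypothesis.Theorems.circulantFourier_assembly_proof @ 54df80d7053a (prover) · by planner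
sources: Hrubes2020, Burgisser2000, Valiant1979
[assembly] SensitiveMonotoneHard → HrubesBridge → RealForms → CircHub → ValiantsHypothesis. -/
@[route_item "route-ValiantsHypothesis-CirculantFourier"]
def Assembly : Prop :=
  SensitiveMonotoneHard → HrubesBridge → RealForms → CircHub → ValiantsHypothesis

/-! D-0027 §2.1 — DECIDING THEOREM (planner-authored via `route open/edit --closes-file`; by planner-rbadge-ValiantsHypothesis-CirculantFou-f71539a2-g2-0 2026-08-15T16:18:50Z):
its hypotheses are this route's items and its conclusion the sub-problem Statement (glue_lint), and it elaborates with this file. -/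

@[closes "route-ValiantsHypothesis-CirculantFourier"] theorem closes (hT : CircPermNotPComputable) (hHub : CircHub) : _root_.ValiantsHypothesis := hHub hT

end Summit.ValiantsHypothesis.ValiantsHypothesis.Theses.CirculantFourier
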